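import Mathlib
import Summits.KontsevichZagierPeriods.KontsevichZagierPeriods.Theses.SymplecticScissors
import Literature.NumberTheory.Transcendental.CurvePeriods
import Literature.NumberTheory.Transcendental.OnePeriods

/-!
# Sketch — crux-ideate round 1, ideator 3, crux `SymplecticScissors.RealOnePeriodRelations`
(stmt-KontsevichZagierPeriods-10042)

First lemmas of the two idea cards, stated over existing declarations (no proofs claimed except
`crux_iff`, `realises_congr_mem_cov`-type sanity `example`s).

* Card `chart-grid-transport`: `ChartGreen`, `GridLemma`, `ThetaR4Pointwise`, `ThetaR3DimOne`,
  `Normalisation`, `TransportPrinciple`, and the unconditional layers `RationalLayer`,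
  `EllipticOvalLayer` (transport of the tree's PROVED
  `CurvePeriods.huberWustholzCurvePeriods_of_puncturedLine` /
  `CurvePeriods.huberWustholzCurvePeriods_ellipticLoops_puncturedLine`).
* Card `branched-cover-sector-certificates`: `SectorIdentity n`, `HalfDiscFlatteningContinuous`.
-/

noncomputable section

open scoped BigOperators
open Set MeasureTheory

namespace Summit.KontsevichZagierPeriods.KontsevichZagierPeriods.Cruxes.RealOnePeriodRelations.Ideator3

open Literature.NumberTheory.Transcendental
open Literature.NumberTheory.Transcendental.CurvePeriods

/-! ## The crux, unfolded -/

/-- The Green generator set of the crux, verbatim. -/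
def greenSet : Set KZ.FormalRep :=
  {g : KZ.FormalRep | ∃ (Δ : Set (Fin 2 → ℝ)) (A B S : (Fin 2 → ℝ) → ℝ)
    (r₀₁ r₁₂ r₀₂ : KZ.IntegralRep 1), Δ = {p | 0 ≤ p 0 ∧ 0 ≤ p 1 ∧ p 0 + p 1 ≤ 1} ∧
    IsSemialgebraicFunOn ℚ Δ A ∧ IsSemialgebraicFunOn ℚ Δ B ∧ ContinuousOn A Δ ∧ ContinuousOn B Δ ∧
    (∀ p : Fin 2 → ℝ, 0 < p 0 → 0 < p 1 → p 0 + p 1 < 1 →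
      HasFDerivAt S (A p • ContinuousLinearMap.proj (R := ℝ) (φ := fun _ : Fin 2 => ℝ) 0 +
        B p • ContinuousLinearMap.proj (R := ℝ) (φ := fun _ : Fin 2 => ℝ) 1) p) ∧
    r₀₁.domain = {z | z 0 ∈ Set.Ioo 0 1} ∧ r₁₂.domain = {z | z 0 ∈ Set.Ioo 0 1} ∧
    r₀₂.domain = {z | z 0 ∈ Set.Ioo 0 1} ∧ (∀ z ∈ r₀₁.domain, r₀₁.integrand z = A ![z 0, 0]) ∧
    (∀ z ∈ r₁₂.domain, r₁₂.integrand z = B ![1 - z 0, z 0] - A ![1 - z 0, z 0]) ∧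
    (∀ z ∈ r₀₂.domain, r₀₂.integrand z = B ![0, z 0]) ∧
    g = KZ.of r₀₁ + KZ.of r₁₂ - KZ.of r₀₂}

/-- The move group of the crux: rules 1a, 1b, 2 and the Green generator. -/
def M₁ : AddSubgroup KZ.FormalRep :=
  AddSubgroup.closure (KZ.domainAddRel ∪ KZ.integrandAddRel ∪ KZ.changeOfVariablesRel ∪ greenSet)

/-- The dimension-one move group (no Green). -/
def M₁' : AddSubgroup KZ.FormalRep :=
  AddSubgroup.closure (KZ.domainAddRel ∪ KZ.integrandAddRel ∪ KZ.changeOfVariablesRel)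

/-- Formal combinations of 1-dimensional representations. -/
def H₁ : AddSubgroup KZ.FormalRep :=
  AddSubgroup.closure (Set.range fun r : KZ.IntegralRep 1 => KZ.of r)

/-- Sanity: the crux is literally `∀ c ∈ H₁, eval c = 0 → c ∈ M₁`. -/
theorem crux_iff :
    Theses.SymplecticScissors.RealOnePeriodRelations ↔ ∀ c ∈ H₁, KZ.eval c = 0 → c ∈ M₁ :=
  Iff.rfl

theorem M₁'_le_M₁ : M₁' ≤ M₁ :=
  AddSubgroup.closure_mono Set.subset_union_left

/-! ## Realisation of (scaled) symbols by real 1-dimensional representations -/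

/-- `ℂⁿ` as `ℝ²ⁿ` (real parts, then imaginary parts). -/
def realify {n : ℕ} (v : Fin n → ℂ) : Fin (n + n) → ℝ :=
  Fin.append (fun i => (v i).re) (fun i => (v i).im)

/-- A path `γ : [0,1] → ℂⁿ` is `ℚ`-semialgebraic (its real and imaginary coordinates form a
`ℚ`-semialgebraic map on `[0,1]`). For a `CurvePath` (which is `C¹` on `[0,1]`) this is the class of
paths the move world can see; values at rational times are then algebraic points. -/
def IsSAPath {n : ℕ} (γ : ℝ → (Fin n → ℂ)) : Prop :=
  IsSemialgebraicMapOn ℚ {z : Fin 1 → ℝ | z 0 ∈ Icc (0 : ℝ) 1} (fun z => realify (γ (z 0)))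

/-- The complex integrand `ω(γ(t)) · γ′(t)` of a period symbol (cf. `PeriodSymbol.period`). -/
def pathIntegrand {n : ℕ} (ω : Fin n → MvPolynomial (Fin n) ℂ) (γ : ℝ → (Fin n → ℂ)) (t : ℝ) : ℂ :=
  ∑ i, MvPolynomial.eval (γ t) (ω i) * deriv (fun u => γ u i) t

/-- `r` realises the real number `Re (a · ∫_γ ω)` as the 1-dimensional representation
`∫₀¹ Re(a · ω(γ(t)) γ′(t)) dt` (the scalar `a ∈ ℚ̄` is absorbed INTO the integrand; `a = 1` and
`a = −i` give real and imaginary parts). -/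
def Realises (r : KZ.IntegralRep 1) (a : ℂ) {n : ℕ} (ω : Fin n → MvPolynomial (Fin n) ℂ)
    (γ : ℝ → (Fin n → ℂ)) : Prop :=
  r.domain = {z | z 0 ∈ Ioo (0 : ℝ) 1} ∧
    ∀ z ∈ r.domain, r.integrand z = (a * pathIntegrand ω γ (z 0)).re

/-- Two realisations of the same data differ by ONE change-of-variables instance (`Φ = id`);
this is the refuter's `of_sub_of_mem_cov` pattern, recorded as the statement the line uses for
(R1)/(R4) bookkeeping. -/
def RealisesUnique : Prop :=
  ∀ (r r' : KZ.IntegralRep 1) (a : ℂ) (n : ℕ) (ω : Fin n → MvPolynomial (Fin n) ℂ) (γ : ℝ → (Fin n → ℂ)),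
    Realises r a ω γ → Realises r' a ω γ → KZ.of r - KZ.of r' ∈ KZ.changeOfVariablesRel

/-! ## Card A, first lemma: `ChartGreen` — a chart-composed semialgebraic `C¹` triangle is ONE typed
Green instance

Data: a graph chart `ψ` of the smooth affine curve `Z` over the coordinate `i₀` on a convex open
`T ⊂ ℂ` (the shape delivered by `CurveData.IsSmoothAffineCurve.exists_localChart`, plus the
`ℚ`-semialgebraicity of its graph, which holds because `Z(ℂ) ⊂ ℝ²ⁿ` is `ℚ`-semialgebraic and `T` can
be taken to be a rational box), a polynomial form `ω` over `ℚ̄`, a scalar `a ∈ ℚ̄`, and a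
`ℚ`-semialgebraic `C¹` map `P : Δ → T` of the CLOSED standard triangle. Conclusion: the three edge
representations of `Re(a · ψ^*ω)` pulled back by `P` form an element of `M₁` — the typed Green
generator with `A = Re(a g(P) ∂₁P)`, `B = Re(a g(P) ∂₂P)`, `S = Re(a F(P))`, `F′ = g := ψ^*ω / dw`
holomorphic on `T` (primitive on a convex set). -/
def stdTri : Set (Fin 2 → ℝ) := {p | 0 ≤ p 0 ∧ 0 ≤ p 1 ∧ p 0 + p 1 ≤ 1}

@[inherit_doc stdTri]
def ChartGreen : Prop :=
  ∀ (Z : CurveData) (_hZ : Z.IsSmoothAffineCurve) (ω : Fin Z.n → MvPolynomial (Fin Z.n) ℂ)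
    (_hω : ∀ i, HasAlgCoeffs (ω i)) (a : ℂ) (_ha : IsAlgebraic ℚ a)
    (i₀ : Fin Z.n) (T : Set ℂ) (ψ : ℂ → (Fin Z.n → ℂ)),
    Convex ℝ T → IsOpen T → AnalyticOnNhd ℂ ψ T → MapsTo ψ T Z.points → (∀ w ∈ T, ψ w i₀ = w) →
    IsSemialgebraicMapOn ℚ {q : Fin 2 → ℝ | (⟨q 0, q 1⟩ : ℂ) ∈ T} (fun q => realify (ψ ⟨q 0, q 1⟩)) →
    ∀ (P : (Fin 2 → ℝ) → ℂ),
      IsSemialgebraicMapOn ℚ stdTri (fun p => ![(P p).re, (P p).im]) →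
      ContDiffOn ℝ 1 P stdTri → MapsTo P stdTri T →
    ∀ (r₀₁ r₁₂ r₀₂ : KZ.IntegralRep 1),
      Realises r₀₁ a ω (fun t => ψ (P ![t, 0])) →
      Realises r₁₂ a ω (fun t => ψ (P ![1 - t, t])) →
      Realises r₀₂ a ω (fun t => ψ (P ![0, t])) →
      KZ.of r₀₁ + KZ.of r₁₂ - KZ.of r₀₂ ∈ M₁

/-! ## Card A, load-bearing lemma: `GridLemma` — CONTINUOUSLY homotopic semialgebraic `C¹` paths on
`Z` realise the same class modulo `M₁`

The move-world twin of the tree's PROVED `CurvePeriods.span_single_sub_single_of_continuousHomotopy`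
(same hypotheses on `H`; the two paths are in addition `ℚ`-semialgebraic). Proof plan: the tree's
`exists_grid_charts` (Lebesgue-number grid of chart cells), ALGEBRAIC replacement of the interior
grid vertices (`mem_closure_algebraicPoints`; the side vertices `γᵣ(q/N)` are already algebraic since
`γᵣ` is semialgebraic and `q/N ∈ ℚ`), chart-STRAIGHT edges (no `C¹` gluing: an edge is a SUM of
representations, rule 1a), one `ChartGreen` instance per cell (chart-affine) and per side piece
(straight-line homotopy in the chart coordinate between the lift of `γᵣ` and the chart segment),
telescoping in `FormalRep`. No Nash tube, no Weierstrass approximation, no bump functions. -/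
def GridLemma : Prop :=
  ∀ (Z : CurveData) (_hZ : Z.IsSmoothAffineCurve) (ω : Fin Z.n → MvPolynomial (Fin Z.n) ℂ)
    (_hω : ∀ i, HasAlgCoeffs (ω i)) (a : ℂ) (_ha : IsAlgebraic ℚ a)
    (H : ℝ × ℝ → (Fin Z.n → ℂ)), ContinuousOn H (Icc (0 : ℝ) 1 ×ˢ Icc (0 : ℝ) 1) →
    (∀ x ∈ Icc (0 : ℝ) 1 ×ˢ Icc (0 : ℝ) 1, H x ∈ Z.points) →
    (∀ s ∈ Icc (0 : ℝ) 1, H (s, 0) = H (0, 0)) → (∀ s ∈ Icc (0 : ℝ) 1, H (s, 1) = H (0, 1)) →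
    ∀ (γ₀ γ₁ : CurvePath Z), IsSAPath γ₀.toFun → IsSAPath γ₁.toFun →
      (∀ t ∈ Icc (0 : ℝ) 1, γ₀.toFun t = H (0, t)) → (∀ t ∈ Icc (0 : ℝ) 1, γ₁.toFun t = H (1, t)) →
    ∀ (r₀ r₁ : KZ.IntegralRep 1), Realises r₀ a ω γ₀.toFun → Realises r₁ a ω γ₁.toFun →
      KZ.of r₀ - KZ.of r₁ ∈ M₁

/-! ## Card A: what `Θ` does with (R4) and (R3) -/

/-- (R4) functoriality is POINTWISE: `(f^*ω′)(γ)·γ′ = ω′(f∘γ)·(f∘γ)′` (chain rule, cf. the tree's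
`CurvePeriods.hasDerivAt_eval_comp` / `period_formPullback`), so the two realisations have the SAME
integrand and differ by one rule-2 instance with `Φ = id`. No dimension two, whatever the field of
definition of `f` (non-real morphisms cost nothing here). -/
def ThetaR4Pointwise : Prop :=
  ∀ (Z Z' : CurveData) (f : Fin Z'.n → MvPolynomial (Fin Z.n) ℂ)
    (ω' : Fin Z'.n → MvPolynomial (Fin Z'.n) ℂ) (γ : CurvePath Z) (γ' : CurvePath Z') (a : ℂ),
    (∀ t ∈ Icc (0 : ℝ) 1, γ'.toFun t = fun j => MvPolynomial.eval (γ.toFun t) (f j)) →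
    ∀ (r r' : KZ.IntegralRep 1), Realises r a (formPullback f ω') γ.toFun → Realises r' a ω' γ'.toFun →
      KZ.of r - KZ.of r' ∈ KZ.changeOfVariablesRel

/-- (R3) exactness lands in DIMENSION ONE: for `ω = dP`, `u(t) = Re(a · P(γ(t)))` is a
`ℚ`-semialgebraic `C¹` function on `[0,1]` with `u′ =` the integrand, so `[∫₀¹ u′] − [∫₀¹ (u 1 − u 0)]`
lies in the Green-free group `M₁'` (monotonicity pieces of `u`, rule 2 with `Φ = u`, telescoping by 1a:
LevelPairing's `LevelPairingLemma` / `NL1Elimination` pattern). -/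
def ThetaR3DimOne : Prop :=
  ∀ (Z : CurveData) (_hZ : Z.IsSmoothAffineCurve) (P : MvPolynomial (Fin Z.n) ℂ) (_hP : HasAlgCoeffs P)
    (γ : CurvePath Z) (_hγ : IsSAPath γ.toFun) (a : ℂ) (_ha : IsAlgebraic ℚ a)
    (r c : KZ.IntegralRep 1), Realises r a (formD P) γ.toFun →
    c.domain = {z | z 0 ∈ Ioo (0 : ℝ) 1} →
    (∀ z ∈ c.domain, c.integrand z =
      (a * (MvPolynomial.eval (γ.toFun 1) P - MvPolynomial.eval (γ.toFun 0) P)).re) →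
    KZ.of r - KZ.of c ∈ M₁'

/-! ## Card A: normalisation `Ψ` by LOCAL uniformisation (shared step, here with the blow-up plan)

Every real 1-dimensional representation is, modulo rules 1a and 2 only, a sum of realisations of
REAL semialgebraic symbols: cut the domain at the finitely many non-Nash points (1a), compactify
(rule 2), and at each end point flatten the Puiseux branch by `x = e + uᴺ` and separate it from the
other branches by finitely many affine blow-ups `y = g₀ + u(g₁ + u(⋯ + u yₘ))`, so that the arc closes
up to a `C¹` path with algebraic end points on the smooth affine model
`{P_m(u, y_m) = 0, w · D_m(u, y_m) = 1} ⊂ 𝔸³` where the form `y dx` is polynomial. -/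
def Normalisation : Prop :=
  ∀ r : KZ.IntegralRep 1, ∃ (k : ℕ) (s : Fin k → PeriodSymbol) (ρ : Fin k → KZ.IntegralRep 1),
    (∀ j, IsSAPath (s j).γ.toFun) ∧ (∀ j, Realises (ρ j) 1 (s j).ω (s j).γ.toFun) ∧
    (∀ j, ∀ t ∈ Icc (0 : ℝ) 1, (pathIntegrand (s j).ω (s j).γ.toFun t).im = 0) ∧
    KZ.of r - ∑ j, KZ.of (ρ j) ∈ AddSubgroup.closure (KZ.domainAddRel ∪ KZ.changeOfVariablesRel)

/-! ## Card A: the transport principle (how a symbol-level certificate becomes a move certificate)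

`TransportPrinciple S`: for every finitely supported `ℚ̄`-combination `c` of period symbols that the
symbol-level theorem `S` covers, IF `c` is a `ℚ̄`-combination of elementary relations THEN every
"real shadow" of `c` — replace each symbol `s` with coefficient `c s` by a realisation of
`Re(c s · ∫ ω_s)` along an `ℚ`-semialgebraic representative of the homotopy class of `γ_s` — lies in
`M₁`. With `S =` the hypothesis-free support condition this is `Θ` killing (R1)–(R5); the crux is
`TransportPrinciple ⊤ ∧ HuberWustholzCurvePeriods ∧ Normalisation ⟹ RealOnePeriodRelations`
(plus the `K`-linear bookkeeping), and the LAYERS below are `TransportPrinciple` applied to the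
tree's PROVED cases of Huber–Wüstholz. -/
def TransportPrinciple (Covers : PeriodSymbol → Prop) : Prop :=
  ∀ (c : PeriodSymbol →₀ ℂ), (∀ s, IsAlgebraic ℚ (c s)) → (∀ s ∈ c.support, Covers s) →
    (∃ (k : ℕ) (ρ : Fin k → (PeriodSymbol →₀ ℂ)) (b : Fin k → ℂ),
      (∀ l, IsElementaryRelation (ρ l)) ∧ (∀ l, IsAlgebraic ℚ (b l)) ∧ c = ∑ l, b l • ρ l) →
    ∀ (rep : (s : PeriodSymbol) → CurvePath s.Z) (real : PeriodSymbol → KZ.IntegralRep 1),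
      (∀ s ∈ c.support, IsSAPath (rep s).toFun ∧ (rep s).toFun 0 = s.γ.toFun 0 ∧
        (rep s).toFun 1 = s.γ.toFun 1 ∧
        ∃ H : ℝ × ℝ → (Fin s.Z.n → ℂ), ContinuousOn H (Icc (0 : ℝ) 1 ×ˢ Icc (0 : ℝ) 1) ∧
          (∀ x ∈ Icc (0 : ℝ) 1 ×ˢ Icc (0 : ℝ) 1, H x ∈ s.Z.points) ∧
          (∀ u ∈ Icc (0 : ℝ) 1, H (u, 0) = H (0, 0)) ∧ (∀ u ∈ Icc (0 : ℝ) 1, H (u, 1) = H (0, 1)) ∧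
          (∀ t ∈ Icc (0 : ℝ) 1, s.γ.toFun t = H (0, t)) ∧ (∀ t ∈ Icc (0 : ℝ) 1, (rep s).toFun t = H (1, t))) →
      (∀ s ∈ c.support, Realises (real s) (c s) s.ω (rep s).toFun) →
      ∑ s ∈ c.support, KZ.of (real s) ∈ M₁

/-! ## Card A: the two UNCONDITIONAL layers (values: Baker periods; `1, ω₁, ω₂, η₁, η₂` + logs) -/

/-- GENUS-ZERO LAYER (kernel form of "Baker in the move calculus, Green allowed"): every vanishing
`ℤ`-combination of 1-dimensional representations of KZ's literal rational shape lies in `M₁`.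
Route to it: `Normalisation` lands in punctured lines `Z_a` (rational integrands have genus `0`;
Möbius rule-2 maps bring `∞` to a finite point), the tree's PROVED
`CurvePeriods.huberWustholzCurvePeriods_of_puncturedLine` certifies the symbol combination, and
`TransportPrinciple` realises the certificate. (Green-free sibling: LevelPairing `Dim1Rules12`, open.) -/
def RationalLayer : Prop :=
  ∀ c ∈ AddSubgroup.closure {x : KZ.FormalRep | ∃ r : KZ.IntegralRep 1, r.IsRational ∧ x = KZ.of r},
    KZ.eval c = 0 → c ∈ M₁

/-- NON-CM ELLIPTIC OVAL LAYER: add the complete integrals `∫_e^{e′} p(x) dx / √(4x³ − g₂x − g₃)` over a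
bounded real oval (`4x³ − g₂x − g₃ > 0` on `(e, e′)`, `= 0` at `e, e′`) of a non-CM curve with
`g₂, g₃ ∈ ℚ`; these are closed paths on the affine Weierstrass curve, so the tree's PROVED
`CurvePeriods.huberWustholzCurvePeriods_ellipticLoops_puncturedLine` certifies, and `TransportPrinciple`
realises. (The unbounded branch and the twisted ovals join by real 2-torsion translations / Kummer,
dimension one — other cards.) -/
def EllipticOvalLayer : Prop :=
  ∀ (g₂ g₃ : ℚ) (L : PeriodPair), L.g₂ = (g₂ : ℂ) → L.g₃ = (g₃ : ℂ) → ¬ L.HasCM →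
    ∀ c ∈ AddSubgroup.closure
      ({x : KZ.FormalRep | ∃ r : KZ.IntegralRep 1, r.IsRational ∧ x = KZ.of r} ∪
       {x : KZ.FormalRep | ∃ (r : KZ.IntegralRep 1) (e e' : ℝ) (p : Polynomial ℚ), e < e' ∧
          r.domain = {z | z 0 ∈ Ioo e e'} ∧
          (∀ x ∈ Ioo e e', 0 < 4 * x ^ 3 - (g₂ : ℝ) * x - g₃) ∧
          4 * e ^ 3 - (g₂ : ℝ) * e - g₃ = 0 ∧ 4 * e' ^ 3 - (g₂ : ℝ) * e' - g₃ = 0 ∧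
          (∀ z ∈ r.domain, r.integrand z =
            Polynomial.aeval (z 0) p / Real.sqrt (4 * (z 0) ^ 3 - (g₂ : ℝ) * (z 0) - g₃)) ∧
          x = KZ.of r}),
      KZ.eval c = 0 → c ∈ M₁

/-- Both layers are literal special cases of the crux (so they are honest `--supports` targets). -/
theorem rationalLayer_of_crux (h : Theses.SymplecticScissors.RealOnePeriodRelations) : RationalLayer := by
  intro c hc h0
  refine (crux_iff.mp h) c ?_ h0
  refine AddSubgroup.closure_mono ?_ hc
  rintro x ⟨r, -, rfl⟩
  exact ⟨r, rfl⟩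

/-! ## Card B: sector certificates (branched-cover planar Green instances)

For `y² = xⁿ − 1`, Cauchy on the sector `{0 ≤ arg x ≤ π/n}` for `dx / h`, `h` the branch of
`√(xⁿ − 1)` continuous on the closed sector minus `{1}` with `h(0) = i`, gives — after flattening the
corner at the branch point `x = 1` by `x = 1 + ρ² e^{iφ}` and the corner at `∞` by `x = q⁻² e^{iθ}` —
finitely many TYPED Green instances proving
`∫₁^∞ (xⁿ−1)^{-1/2} dx = tan(π/n) · ∫₀¹ (1−xⁿ)^{-1/2} dx` (and `= sin(π/n) · ∫₀^∞ (1+tⁿ)^{-1/2} dt`)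
inside `M₁`: a relation induced by the non-real automorphism `x ↦ e^{2πi/n} x` (CM), certified without
any real sheet (kit job j008024: identities to 30 digits for `n = 3..8`; coefficient continuity of the
flattened pieces; `n = 5` is genus 2, beyond Kummer descent). -/
def SectorIdentity (n : ℕ) : Prop :=
  ∀ (r₁ r₀ : KZ.IntegralRep 1),
    r₁.domain = {z | 1 < z 0} → (∀ z ∈ r₁.domain, r₁.integrand z = ((z 0) ^ n - 1) ^ (-(1 / 2 : ℝ))) →
    r₀.domain = {z | 0 < z 0 ∧ z 0 < 1} →
    (∀ z ∈ r₀.domain, r₀.integrand z = Real.tan (Real.pi / n) * (1 - (z 0) ^ n) ^ (-(1 / 2 : ℝ))) →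
    KZ.of r₁ - KZ.of r₀ ∈ M₁

/-- The corner flattening at a simple branch point is what makes the Green instance TYPABLE: the
`dρ`-coefficient of the pull-back of `dx/√(xⁿ−1)` under `x = 1 + ρ² e^{iφ}` extends CONTINUOUSLY to
`ρ = 0` (limit `(2/√n) e^{iφ/2}`), whereas in the naive polar coordinate it blows up like `r^{-1/2}`.
Stated for the principal-branch model `g(x) = (i √(1 − xⁿ))⁻¹` on the open upper half-disc. -/
def HalfDiscFlatteningContinuous (n : ℕ) : Prop :=
  ∃ ρ₀ > (0 : ℝ), ContinuousOn
    (fun p : ℝ × ℝ =>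
      if p.1 = 0 then ((2 / Real.sqrt n : ℝ) : ℂ) * Complex.exp (Complex.I * ((p.2 : ℂ) / 2))
      else (Complex.I * ((1 : ℂ) - (1 + (p.1 : ℂ) ^ 2 * Complex.exp (Complex.I * (p.2 : ℂ))) ^ n) ^ (1 / 2 : ℂ))⁻¹ *
        (2 * (p.1 : ℂ) * Complex.exp (Complex.I * (p.2 : ℂ))))
    (Icc 0 ρ₀ ×ˢ Ioo 0 Real.pi)

end Summit.KontsevichZagierPeriods.KontsevichZagierPeriods.Cruxes.RealOnePeriodRelations.Ideator3

end
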